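import Mathlib

/-!
# The flat tangent count at an `e = 1` Eisenstein cell (algebraic core of THEOREM H, s43/s44)

In the solo-informed cell programme (FINDING_H, s43) the flat adjoint Selmer group
`H = H¹_fl(G_{F,{7}}, ad⁰ ρ̄_F)` of the base-changed Ribet representation embeds into the
unit plane `U = O_F^× ⊗ 𝔽₇` (dimension `2`) as the kernel of a secondary linear map
`Θ₂ : U → coker(res_v)` whose target has dimension `≤ 1` (once the primary map `Θ` vanishes
identically, which is the computed fact), while trace-determinacy (LEMMA H3) bounds `dim H ≤ 1`.
The purely linear-algebraic and commutative-algebraic steps are collected here: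

* `one_le_finrank_ker` : a linear map from a `2`-dimensional space to a space of dimension
  `≤ 1` has kernel of dimension `≥ 1` (rank–nullity);
* `finrank_ker_eq_one` : if moreover the kernel has dimension `≤ 1`, it has dimension exactly
  `1` and the map is non-zero (so `Θ₂` has rank exactly `1`);
* `le_eigenspace_of_finrank_eq_one` / `eq_of_le_of_finrank_eq_one` : a `1`-dimensional line
  stable under an endomorphism `σ` lies in an eigenspace of `σ`, and equals any `1`-dimensional
  submodule containing it (so `H` is one of the two `σ`-eigenlines of `U`);
* `map_maximalIdeal_eq_of_surjective` / `maximalIdeal_eq_span_image` : under a surjective ring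
  map of local rings the maximal ideal maps onto the maximal ideal, hence a generating set of
  `𝔪_A` maps to a generating set of `𝔪_B` (the number of generators of the maximal ideal does
  not go up under quotients: `t_{R_B} ≤ t_{R'} = 1` in THEOREM H (ii)).

No number theory is formalised here.
-/

namespace Summit.Langlands.Langlands.Theorems

open Module

section LinearAlgebra

variable {K V W : Type*} [Field K] [AddCommGroup V] [Module K V] [AddCommGroup W] [Module K W]

/-- Rank–nullity: a linear map out of a `2`-dimensional space into a space of dimension `≤ 1`
has a kernel of dimension at least `1`. -/
theorem one_le_finrank_ker [FiniteDimensional K V] [FiniteDimensional K W] (f : V →ₗ[K] W)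
    (hV : finrank K V = 2) (hW : finrank K W ≤ 1) : 1 ≤ finrank K (LinearMap.ker f) := by
  have hrn := LinearMap.finrank_range_add_finrank_ker f
  have hr : finrank K (LinearMap.range f) ≤ 1 :=
    (Submodule.finrank_le (LinearMap.range f)).trans hW
  omega

/-- If in addition the kernel has dimension `≤ 1` (trace-determinacy), then it has dimension
exactly `1` and the map is non-zero. -/
theorem finrank_ker_eq_one [FiniteDimensional K V] [FiniteDimensional K W] (f : V →ₗ[K] W)
    (hV : finrank K V = 2) (hW : finrank K W ≤ 1) (hH : finrank K (LinearMap.ker f) ≤ 1) :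
    finrank K (LinearMap.ker f) = 1 ∧ f ≠ 0 := by
  have h1 := one_le_finrank_ker f hV hW
  refine ⟨le_antisymm hH h1, ?_⟩
  intro hf
  have hker : LinearMap.ker f = ⊤ := by
    rw [hf]; exact LinearMap.ker_zero
  have : finrank K (LinearMap.ker f) = 2 := by
    rw [hker, finrank_top, hV]
  omega

/-- A `1`-dimensional submodule stable under an endomorphism `s` is contained in an eigenspace
of `s`. -/
theorem le_eigenspace_of_finrank_eq_one (s : Module.End K V) (L : Submodule K V)
    (hL : finrank K L = 1) (hstab : ∀ v ∈ L, s v ∈ L) :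
    ∃ μ : K, L ≤ Module.End.eigenspace s μ := by
  obtain ⟨v, hv⟩ := finrank_eq_one_iff'.mp hL
  obtain ⟨hv0, hspan⟩ := hv
  -- `s v ∈ L = K • v`
  obtain ⟨μ, hμ⟩ := hspan ⟨s v, hstab v v.2⟩
  refine ⟨μ, ?_⟩
  intro w hw
  obtain ⟨c, hc⟩ := hspan ⟨w, hw⟩
  rw [Module.End.mem_eigenspace_iff]
  have hsv : s (v : V) = μ • (v : V) := by
    have := congrArg Subtype.val hμ
    simpa using this.symm
  have hwv : (w : V) = c • (v : V) := by
    have := congrArg Subtype.val hc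
    simpa using this.symm
  rw [hwv, map_smul, hsv, smul_comm]

/-- A `1`-dimensional submodule contained in a submodule of dimension `1` equals it. -/
theorem eq_of_le_of_finrank_eq_one [FiniteDimensional K V] (L M : Submodule K V)
    (hLM : L ≤ M) (hL : finrank K L = 1) (hM : finrank K M = 1) : L = M :=
  Submodule.eq_of_le_of_finrank_eq hLM (by rw [hL, hM])

end LinearAlgebra

section LocalRings

open IsLocalRing

variable {A B : Type*} [CommRing A] [CommRing B] [IsLocalRing A] [IsLocalRing B]

/-- Under a surjective ring homomorphism of local rings the maximal ideal maps onto the maximal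
ideal. -/
theorem map_maximalIdeal_eq_of_surjective (π : A →+* B) (hπ : Function.Surjective π) :
    Ideal.map π (maximalIdeal A) = maximalIdeal B := by
  apply le_antisymm
  · -- the image is a proper ideal, hence inside the maximal ideal
    apply IsLocalRing.le_maximalIdeal
    intro htop
    have h1 : (1 : B) ∈ Ideal.map π (maximalIdeal A) := by rw [htop]; exact Submodule.mem_top
    rw [Ideal.mem_map_iff_of_surjective π hπ] at h1
    obtain ⟨a, ha, ha1⟩ := h1
    have hu : IsUnit (1 - a) := by
      by_contra hna
      have hmem : 1 - a ∈ maximalIdeal A := (IsLocalRing.mem_maximalIdeal _).mpr hna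
      have : (1 : A) ∈ maximalIdeal A := by
        have h := Ideal.add_mem _ hmem ha
        rwa [sub_add_cancel] at h
      exact (IsLocalRing.maximalIdeal.isMaximal A).ne_top
        ((Ideal.eq_top_iff_one _).mpr this)
    have hzero : π (1 - a) = 0 := by rw [map_sub, map_one, ha1, sub_self]
    have hu' : IsUnit (π (1 - a)) := hu.map π
    rw [hzero] at hu'
    exact (IsLocalRing.maximalIdeal.isMaximal B).ne_top
      (Ideal.eq_top_of_isUnit_mem _ (Ideal.zero_mem _) hu')
  · intro b hb
    obtain ⟨a, rfl⟩ := hπ b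
    have ha : a ∈ maximalIdeal A := by
      rw [IsLocalRing.mem_maximalIdeal] at hb ⊢
      intro hu
      exact hb (hu.map π)
    exact Ideal.mem_map_of_mem π ha

/-- Hence a generating set of `𝔪_A` maps to a generating set of `𝔪_B`: the minimal number of
generators of the maximal ideal does not increase under surjections of local rings. -/
theorem maximalIdeal_eq_span_image (π : A →+* B) (hπ : Function.Surjective π) (S : Set A)
    (hS : maximalIdeal A = Ideal.span S) : maximalIdeal B = Ideal.span (π '' S) := by
  rw [← map_maximalIdeal_eq_of_surjective π hπ, hS, Ideal.map_span]

/-- In particular, if `𝔪_A` is generated by `p` and one further element `y` (relative embedding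
dimension `≤ 1` over the coefficient ring), then so is `𝔪_B`. -/
theorem maximalIdeal_eq_span_pair (π : A →+* B) (hπ : Function.Surjective π) (p y : A)
    (hS : maximalIdeal A = Ideal.span {p, y}) : maximalIdeal B = Ideal.span {π p, π y} := by
  rw [maximalIdeal_eq_span_image π hπ {p, y} hS, Set.image_pair]

end LocalRings

end Summit.Langlands.Langlands.Theorems
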